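import Summits.QuantumAdvantage.QuantumAdvantage.Theses.LinnikCubicClassGroups
import Literature.Computability.QuantumComplexity.FBQPOracleAccess
import Literature.Computability.Complexity.OracleJoin
import Literature.Computability.Complexity.CodeFPStringKit
import Literature.Computability.Complexity.CodeFPListKit
import Literature.Computability.Complexity.CodeFPLists

/-!
# Crux `LinnikCubicClassGroups.PureCubicClassGroupFBQP` (stmt-QuantumAdvantage-11544) — stub `stub_assemblySampler`

Line `arakelov-giant-step-cycle`, S6b (skeleton v7 signature: the `FP` program of the accepted coin-block values,
`stub_assemblySamplerAcc`, is a hypothesis). Two facts about the classical sampler: (1) the bit-graph language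
`FACTBITS` of the prime factorisation is in `BQP` — the tree's brick `factorGraph_mem_BQP` (`FBQPOracleAccess.lean`,
Shor + classical wrap); (2) for every `C` and every answer function `ord` of the core language, ONE
`G ∈ FP^{FACTBITS ⊕ coreLang(ord)}` outputs on `⟨x, c⟩` the zero word if `m = decodeNat x` is a cube and otherwise the
`2|x|+8` low bits of `ord m (ACC x c C)`. Program (an `AdQuery.AdPres` over the join): `stage₁ = AdPres.batch` asking
`0·⟨x, bin i⟩` for `i < 4(|z|+2)²` (answers = the padded code of `s = encode (primeFactorsList m)`), `unpad_exists`
(recovers `s`), `stage₂ = AdPres.batch` asking `1·⟨⟨x, ⟨qs, ACC x c C⟩⟩, bin i⟩` for `i < 2|w|+8` (`qs = decNatList s`), and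
an `FP` output stage: the cube flag `∀ q ∈ qs, 3 ∣ #q` (`samplerCube_iff`), then `0^{2|x|+8}` or the first `2|x|+8` answers.
-/

set_option linter.dupNamespace false

namespace Summit.QuantumAdvantage.QuantumAdvantage.Theorems.LinnikCubicClassGroups

open Computability (encodeNat decodeNat encodingNatBool)
open Literature.Computability.Complexity (boolPair boolUnpair boolUnpair_boolPair encodingListNatBool FP FPRel Oracle
  oracleJoin CodeFP comp_mem_FP bitsToNat fanoutFn fanoutFn_mem_FP fanoutFn_apply cons_mem_FP)
open Literature.Computability.Complexity.CodeFP
open Literature.Computability.Complexity.Brick (fstF sndF fstF_mem_FP sndF_mem_FP fstF_boolPair sndF_boolPair canonF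
  canonF_mem_FP canonF_eq_encodeNat_decodeNat)
open Literature.Computability.Complexity.Knapsack (decNatList canonLFn canonLFn_eq canonLFn_mem_FP decNatList_encode)
open Literature.Computability.Complexity.AdQuery (AdPres)
open Literature.Computability.Cryptography (BQP)
open Literature.Computability.QuantumComplexity (factorGraph_mem_BQP unpad_exists unpad_eq getD_pad
  length_encode_primeFactorsList_le)

/-! ## The cube test on the prime factorisation -/

/-- **`m` is a cube iff every multiplicity of its prime factorisation is divisible by `3`** (all `m`, including
`0 = 0³` and `1 = 1³` with empty factorisation). -/
theorem samplerCube_iff (m : ℕ) :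
    (∃ r : ℕ, r ^ 3 = m) ↔ ∀ q ∈ m.primeFactorsList, 3 ∣ m.primeFactorsList.count q := by
  rcases Nat.eq_zero_or_pos m with rfl | hm
  · exact ⟨fun _ q hq => by simp at hq, fun _ => ⟨0, rfl⟩⟩
  constructor
  · rintro ⟨r, rfl⟩ q -
    rw [Nat.primeFactorsList_count_eq, Nat.factorization_pow]
    exact ⟨r.factorization q, by simp⟩
  · intro h
    refine ⟨∏ q ∈ m.primeFactorsList.toFinset, q ^ (m.primeFactorsList.count q / 3), ?_⟩
    rw [← Finset.prod_pow]
    conv_rhs => rw [← Nat.prod_primeFactorsList hm.ne', Finset.prod_list_count]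
    refine Finset.prod_congr rfl fun q hq => ?_
    rw [← pow_mul, Nat.div_mul_cancel (h q (List.mem_toFinset.1 hq))]

/-! ## The `FP` stages -/

/-- The first query maker: `⟨z, bin i⟩ ↦ 0·⟨fstF z, bin i⟩`. -/
theorem sampler_f₁_mem_FP : (List.cons false ∘ fanoutFn (fstF ∘ fstF) sndF : List Bool → List Bool) ∈ FP :=
  comp_mem_FP (cons_mem_FP false) (fanoutFn_mem_FP (comp_mem_FP fstF_mem_FP fstF_mem_FP) sndF_mem_FP)

/-- **The second query maker** (`FP`): `⟨⟨⟨x, c⟩, s⟩, bin i⟩ ↦ 1·⟨⟨x, ⟨decNatList s, ACC x c⟩⟩, bin i⟩`, given an `FP`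
program `acc ⟨x, c⟩ = encode (ACC x c)`. -/
theorem sampler_f₂_exists {acc : List Bool → List Bool} (hacc : acc ∈ FP) : ∃ f₂ : List Bool → List Bool, f₂ ∈ FP ∧
    ∀ (x c s : List Bool) (i : ℕ), f₂ (boolPair (boolPair (boolPair x c) s) (encodeNat i)) =
      true :: boolPair (boolPair x (boolPair (encodingListNatBool.encode (decNatList s)) (acc (boolPair x c)))) (encodeNat i) := by
  refine ⟨List.cons true ∘ fanoutFn (fanoutFn (fstF ∘ fstF ∘ fstF) (fanoutFn (canonLFn ∘ sndF ∘ fstF)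
    (acc ∘ fstF ∘ fstF))) sndF, comp_mem_FP (cons_mem_FP true) (fanoutFn_mem_FP (fanoutFn_mem_FP
      (comp_mem_FP fstF_mem_FP (comp_mem_FP fstF_mem_FP fstF_mem_FP)) (fanoutFn_mem_FP (comp_mem_FP canonLFn_mem_FP
      (comp_mem_FP sndF_mem_FP fstF_mem_FP)) (comp_mem_FP hacc (comp_mem_FP fstF_mem_FP fstF_mem_FP)))) sndF_mem_FP),
    fun x c s i => ?_⟩
  simp only [Function.comp_apply, fanoutFn_apply, fstF_boolPair, sndF_boolPair, canonLFn_eq]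

/-- **The output stage** (`FP`): on `⟨⟨⟨x, c⟩, s⟩, a⟩`, the zero word of length `2|x|+8` if every multiplicity of
`decNatList s` is divisible by `3`, else the first `2|x|+8` bits of `a`. -/
theorem sampler_out_exists : ∃ out : List Bool → List Bool, out ∈ FP ∧ ∀ x c s a : List Bool,
    out (boolPair (boolPair (boolPair x c) s) a) =
      if (decNatList s).all (fun q => decide ((decNatList s).count q % 3 = 0)) then List.replicate (2 * x.length + 8) false
      else a.take (2 * x.length + 8) := by
  -- fields, as a typed program on the code `pairE (pairE (pairE strE strE) strE) strE`
  have cX : CodeFP (pairE (pairE (pairE strE strE) strE) strE) strE (fun t => t.1.1.1) := ((fst _ _).fst').fst'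
  have cQs : CodeFP (pairE (pairE (pairE strE strE) strE) strE) (rawE natE) (fun t => decNatList t.1.2) :=
    (rawOfList natE).comp ⟨canonLFn ∘ sndF ∘ fstF, comp_mem_FP canonLFn_mem_FP (comp_mem_FP sndF_mem_FP fstF_mem_FP),
      fun t => by
        simp only [Function.comp_apply, pairE_apply, fstF_boolPair, sndF_boolPair, canonLFn_eq]
        rw [show (encodingListNatBool.encode : List ℕ → List Bool) = listE natE from listE_eq encodingNatBool]; rfl⟩
  have cN : CodeFP (pairE (pairE (pairE strE strE) strE) strE) unE (fun t => 2 * t.1.1.1.length + 8) :=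
    unAdd.comp (((unMulConst 2).comp (strLength.comp cX)).pair (const _ 8))
  have cFlag : CodeFP (pairE (pairE (pairE strE strE) strE) strE) bitE
      (fun t => (decNatList t.1.2).all fun q => decide ((decNatList t.1.2).count q % 3 = 0)) :=
    ((all (natEq.comp ((natMod.comp ((rawCountNat.comp ((snd _ _).pair (cQs.comp (fst _ _)))).pair (const _ 3))).pair
      (const _ 0)))).comp ((CodeFP.id _).pair cQs)).congr fun _ => rfl
  have cZero : CodeFP (pairE (pairE (pairE strE strE) strE) strE) strE (fun t => List.replicate (2 * t.1.1.1.length + 8) false) :=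
    (bitsToStr.comp ((replicateOf bitE).comp ((const _ false).pair cN))).congr fun _ => rfl
  have cTake : CodeFP (pairE (pairE (pairE strE strE) strE) strE) strE (fun t => t.2.take (2 * t.1.1.1.length + 8)) :=
    strTake.comp (cN.pair (snd _ _))
  obtain ⟨out, hout, hs⟩ := cFlag.ite cZero cTake
  exact ⟨out, hout, fun x c s a => hs (((x, c), s), a)⟩


/-! ## The registered stub -/

/-- **S6b `stub_assemblySampler`** (skeleton v7 signature): from the `FP` program of the accepted values
(`stub_assemblySamplerAcc`), (1) `FACTBITS ∈ BQP` and (2) the sampler is ONE `FP`-function relative to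
`FACTBITS ⊕ coreLang(ord)` with the stated input–output behaviour. -/
theorem stub_assemblySampler :
    (∀ C : ℕ, ∃ acc : List Bool → List Bool, acc ∈ FP ∧ ∀ x c : List Bool,
    acc (boolPair x c) = encodingListNatBool.encode
      ((List.range (600 * (Nat.log 2 ((27 * decodeNat x ^ 2) ^ C) + 1) ^ 2)).filterMap fun k =>
        ((List.range (38400 * (Nat.log 2 ((27 * decodeNat x ^ 2) ^ C) + 1) ^ 3)).map fun j =>
          bitsToNat ((c.drop ((k * (38400 * (Nat.log 2 ((27 * decodeNat x ^ 2) ^ C) + 1) ^ 3) + j) *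
            (Nat.log 2 ((27 * decodeNat x ^ 2) ^ C) + 1))).take
            (Nat.log 2 ((27 * decodeNat x ^ 2) ^ C) + 1))).find? fun v =>
          decide (v.Prime ∧ v ≤ (27 * decodeNat x ^ 2) ^ C ∧ ¬ v ∣ 3 * decodeNat x))) →
    {u : List Bool | ∃ (x : List Bool) (i : ℕ), u = boolPair x (encodeNat i) ∧
        ((encodingListNatBool.encode (decodeNat x).primeFactorsList).flatMap (fun b => [true, b])).getD i false =
          true} ∈ BQP ∧
    ∀ (C : ℕ) (ord : ℕ → List ℕ → ℕ), ∃ G : List Bool → List Bool,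
      G ∈ FPRel (Oracle.ofLanguage (oracleJoin
        {u : List Bool | ∃ (x : List Bool) (i : ℕ), u = boolPair x (encodeNat i) ∧
          ((encodingListNatBool.encode (decodeNat x).primeFactorsList).flatMap (fun b => [true, b])).getD i false =
            true}
        {u : List Bool | ∃ (x : List Bool) (qs ps : List ℕ) (i : ℕ),
          u = boolPair (boolPair x (boolPair (encodingListNatBool.encode qs) (encodingListNatBool.encode ps)))
            (encodeNat i) ∧
          (∀ q ∈ qs, q.Prime) ∧ qs.prod = decodeNat x ∧ (¬ ∃ r : ℕ, r ^ 3 = decodeNat x) ∧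
          (∀ p ∈ ps, p.Prime ∧ ¬ p ∣ 3 * decodeNat x) ∧ (ord (decodeNat x) ps).testBit i = true})) ∧
      ∀ x c : List Bool,
        ((∃ r : ℕ, r ^ 3 = decodeNat x) → G (boolPair x c) = List.replicate (2 * x.length + 8) false) ∧
        ((∀ r : ℕ, r ^ 3 ≠ decodeNat x) → G (boolPair x c) =
          List.ofFn (fun i : Fin (2 * x.length + 8) => (ord (decodeNat x)
            (((List.range (600 * (Nat.log 2 ((27 * decodeNat x ^ 2) ^ C) + 1) ^ 2)).filterMap fun k =>
              ((List.range (38400 * (Nat.log 2 ((27 * decodeNat x ^ 2) ^ C) + 1) ^ 3)).map fun j =>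
                bitsToNat ((c.drop ((k * (38400 * (Nat.log 2 ((27 * decodeNat x ^ 2) ^ C) + 1) ^ 3) + j) *
                  (Nat.log 2 ((27 * decodeNat x ^ 2) ^ C) + 1))).take
                  (Nat.log 2 ((27 * decodeNat x ^ 2) ^ C) + 1))).find? fun v =>
                decide (v.Prime ∧ v ≤ (27 * decodeNat x ^ 2) ^ C ∧ ¬ v ∣ 3 * decodeNat x)))).testBit i.val)) := by
  intro hAcc
  refine ⟨factorGraph_mem_BQP, fun C ord => ?_⟩
  obtain ⟨acc, hacc, haccs⟩ := hAcc C
  obtain ⟨f₂, hf₂, hf₂s⟩ := sampler_f₂_exists hacc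
  obtain ⟨post, hpost, hposts⟩ := unpad_exists
  obtain ⟨out, hout, houts⟩ := sampler_out_exists
  -- the oracle and the four stages
  set FL : Language Bool := {u : List Bool | ∃ (x : List Bool) (i : ℕ), u = boolPair x (encodeNat i) ∧
    ((encodingListNatBool.encode (decodeNat x).primeFactorsList).flatMap (fun b => [true, b])).getD i false = true}
    with hFLdef
  set CL : Language Bool := {u : List Bool | ∃ (x : List Bool) (qs ps : List ℕ) (i : ℕ),
    u = boolPair (boolPair x (boolPair (encodingListNatBool.encode qs) (encodingListNatBool.encode ps))) (encodeNat i) ∧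
    (∀ q ∈ qs, q.Prime) ∧ qs.prod = decodeNat x ∧ (¬ ∃ r : ℕ, r ^ 3 = decodeNat x) ∧
    (∀ p ∈ ps, p.Prime ∧ ¬ p ∣ 3 * decodeNat x) ∧ (ord (decodeNat x) ps).testBit i = true} with hCLdef
  set J : Language Bool := oracleJoin FL CL with hJ
  have hst₁ := AdPres.batch (A := J) sampler_f₁_mem_FP (2 * (2 * (Polynomial.X + 2) ^ 2))
  have hst₂ := AdPres.batch (A := J) hf₂ (2 * Polynomial.X + 8)
  have hG := ((hst₂.comp (hst₁.FP_comp hpost)).FP_comp hout)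
  refine ⟨_, hG.mem_FPRel, fun x c => ?_⟩
  -- oracle answers on the factorisation side
  set s := encodingListNatBool.encode (decodeNat x).primeFactorsList with hs
  have hFL : ∀ i : ℕ, J.boolIndicator (false :: fanoutFn (fstF ∘ fstF) sndF (boolPair (boolPair x c) (encodeNat i))) =
      (s.flatMap fun b => [true, b]).getD i false := by
    intro i
    have hq : false :: fanoutFn (fstF ∘ fstF) sndF (boolPair (boolPair x c) (encodeNat i)) =
        false :: boolPair x (encodeNat i) := by
      simp only [Function.comp_apply, fanoutFn_apply, fstF_boolPair, sndF_boolPair]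
    have hiff : false :: boolPair x (encodeNat i) ∈ J ↔ (s.flatMap fun b => [true, b]).getD i false = true := by
      rw [hJ, Literature.Computability.Complexity.false_cons_mem_oracleJoin]
      constructor
      · rintro ⟨x', i', h, hb⟩
        obtain ⟨rfl, h2⟩ := Prod.mk.inj (Literature.Computability.Complexity.boolPair_injective
          (show Function.uncurry boolPair (x, encodeNat i) = Function.uncurry boolPair (x', encodeNat i') from h))
        rwa [show i = i' from by simpa using congrArg decodeNat h2]
      · exact fun hb => ⟨x, i, rfl, hb⟩
    rw [hq]
    by_cases h : false :: boolPair x (encodeNat i) ∈ J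
    · rw [(Set.mem_iff_boolIndicator _ _).1 h, eq_comm]; exact hiff.1 h
    · rw [(Set.notMem_iff_boolIndicator _ _).1 h, eq_comm, ← Bool.not_eq_true]; exact fun hb => h (hiff.2 hb)
  -- stage 1 and un-padding: `⟨⟨x, c⟩, s⟩`
  have hmid : post (boolPair (boolPair x c) ((List.range ((2 * (2 * (Polynomial.X + 2) ^ 2) : Polynomial ℕ).eval
      (boolPair x c).length)).map fun i => J.boolIndicator (false :: fanoutFn (fstF ∘ fstF) sndF
        (boolPair (boolPair x c) (encodeNat i))))) = boolPair (boolPair x c) s := by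
    rw [hposts, List.length_map, List.length_range]
    simp only [hFL]
    have hP : s.length ≤ (2 * (Polynomial.X + 2) ^ 2 : Polynomial ℕ).eval (boolPair x c).length :=
      (length_encode_primeFactorsList_le x).trans (by
        simp only [Polynomial.eval_mul, Polynomial.eval_pow, Polynomial.eval_add, Polynomial.eval_X, Polynomial.eval_ofNat,
          Literature.Computability.Complexity.length_boolPair]
        exact Nat.mul_le_mul_left 2 (Nat.pow_le_pow_left (by omega) 2))
    rw [show (2 * (2 * (Polynomial.X + 2) ^ 2) : Polynomial ℕ).eval (boolPair x c).length =
      2 * ((2 * (Polynomial.X + 2) ^ 2 : Polynomial ℕ).eval (boolPair x c).length) by simp [Polynomial.eval_mul],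
      Nat.mul_div_cancel_left _ two_pos, unpad_eq s hP]
  -- the factorisation and the handed primes
  have hqs : decNatList s = (decodeNat x).primeFactorsList := by rw [hs, decNatList_encode]
  have hflag : ((decNatList s).all fun q => decide ((decNatList s).count q % 3 = 0)) = true ↔ ∃ r : ℕ, r ^ 3 = decodeNat x := by
    rw [hqs, List.all_eq_true, samplerCube_iff]
    simp only [decide_eq_true_iff]
    exact forall₂_congr fun q _ => (Nat.dvd_iff_mod_eq_zero).symm
  -- oracle answers on the core side (non-cube inputs)
  have hCL : (∀ r : ℕ, r ^ 3 ≠ decodeNat x) → ∀ i : ℕ,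
      J.boolIndicator (f₂ (boolPair (boolPair (boolPair x c) s) (encodeNat i))) =
        (ord (decodeNat x) ((List.range (600 * (Nat.log 2 ((27 * decodeNat x ^ 2) ^ C) + 1) ^ 2)).filterMap fun k =>
          ((List.range (38400 * (Nat.log 2 ((27 * decodeNat x ^ 2) ^ C) + 1) ^ 3)).map fun j =>
            bitsToNat ((c.drop ((k * (38400 * (Nat.log 2 ((27 * decodeNat x ^ 2) ^ C) + 1) ^ 3) + j) *
              (Nat.log 2 ((27 * decodeNat x ^ 2) ^ C) + 1))).take
              (Nat.log 2 ((27 * decodeNat x ^ 2) ^ C) + 1))).find? fun v =>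
            decide (v.Prime ∧ v ≤ (27 * decodeNat x ^ 2) ^ C ∧ ¬ v ∣ 3 * decodeNat x))).testBit i := by
    intro hnc i
    rw [hf₂s, haccs, hqs]
    set ps := (List.range (600 * (Nat.log 2 ((27 * decodeNat x ^ 2) ^ C) + 1) ^ 2)).filterMap fun k =>
          ((List.range (38400 * (Nat.log 2 ((27 * decodeNat x ^ 2) ^ C) + 1) ^ 3)).map fun j =>
            bitsToNat ((c.drop ((k * (38400 * (Nat.log 2 ((27 * decodeNat x ^ 2) ^ C) + 1) ^ 3) + j) *
              (Nat.log 2 ((27 * decodeNat x ^ 2) ^ C) + 1))).take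
              (Nat.log 2 ((27 * decodeNat x ^ 2) ^ C) + 1))).find? fun v =>
            decide (v.Prime ∧ v ≤ (27 * decodeNat x ^ 2) ^ C ∧ ¬ v ∣ 3 * decodeNat x) with hps
    have hgood : ∀ p ∈ ps, p.Prime ∧ ¬ p ∣ 3 * decodeNat x := by
      intro p hp
      obtain ⟨k, -, hk⟩ := List.mem_filterMap.1 hp
      have hp' := List.find?_some hk
      rw [decide_eq_true_eq] at hp'
      exact ⟨hp'.1, hp'.2.2⟩
    have hm0 : decodeNat x ≠ 0 := fun h => hnc 0 (by rw [h]; norm_num)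
    have hiff : true :: boolPair (boolPair x (boolPair (encodingListNatBool.encode (decodeNat x).primeFactorsList)
        (encodingListNatBool.encode ps))) (encodeNat i) ∈ J ↔ (ord (decodeNat x) ps).testBit i = true := by
      rw [hJ, Literature.Computability.Complexity.true_cons_mem_oracleJoin]
      constructor
      · rintro ⟨x', qs', ps', i', hu, -, -, -, -, hbit⟩
        have h1 := congrArg (fun u => (boolUnpair (boolUnpair u).1).1) hu
        have h2 := congrArg (fun u => encodingListNatBool.decode (boolUnpair (boolUnpair (boolUnpair u).1).2).2) hu
        have h3 := congrArg (fun u => decodeNat (boolUnpair u).2) hu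
        simp only [boolUnpair_boolPair, Computability.decode_encodeNat, encodingListNatBool.decode_encode,
          Option.some.injEq] at h1 h2 h3
        subst h1 h2 h3
        exact hbit
      · exact fun hb => ⟨x, _, ps, i, rfl, fun q hq => Nat.prime_of_mem_primeFactorsList hq,
          Nat.prod_primeFactorsList hm0, fun ⟨r, hr⟩ => hnc r hr, hgood, hb⟩
    by_cases h : true :: boolPair (boolPair x (boolPair (encodingListNatBool.encode (decodeNat x).primeFactorsList)
        (encodingListNatBool.encode ps))) (encodeNat i) ∈ J
    · rw [(Set.mem_iff_boolIndicator _ _).1 h, eq_comm]; exact hiff.1 h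
    · rw [(Set.notMem_iff_boolIndicator _ _).1 h, eq_comm, ← Bool.not_eq_true]; exact fun hb => h (hiff.2 hb)
  -- the run
  simp only [Function.comp_apply]
  rw [hmid, houts]
  constructor
  · intro hcube
    rw [if_pos (hflag.2 hcube)]
  · intro hnc
    rw [if_neg (fun h => (hflag.1 h).elim fun r hr => hnc r hr), ← List.map_take, List.take_range,
      Nat.min_eq_left (by simp [Literature.Computability.Complexity.length_boolPair]; omega)]
    simp only [hCL hnc]
    rw [List.ofFn_eq_map, ← List.map_coe_finRange_eq_range (n := 2 * x.length + 8), List.map_map]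
    rfl

end Summit.QuantumAdvantage.QuantumAdvantage.Theorems.LinnikCubicClassGroups
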